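import Summits.ValiantsHypothesis.ValiantsHypothesis.Theorems.KPlusLogSqLawTropicalGradedWalkDomXGlue1
import Summits.ValiantsHypothesis.ValiantsHypothesis.Theorems.KPlusLogSqLawTropicalGradedWalkDomXOne1
import Summits.ValiantsHypothesis.ValiantsHypothesis.Theorems.KPlusLogSqLawTropicalGradedWalkDomXOne2

/-!
# Dominance glue for the `u = 1` excursion, part A: interface and the exchanged columns `0`, `1`

GRW-lite `K = 4` graded-walk family (census side of the tropical root law, all `m`):
dominance glue for the EXCURSION state `(w, 1, 1)`, `2 ≤ w ≤ m − 1`, of the design typed in `KPlusLogSqLawTropicalGradedWalkDefs`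
(Leibniz term: the diagonal term of `(w, 1, 0)` with the rows of the columns `0`, `1` exchanged; potential `UX1` of `…PotX`).
The slack of every rival cell was certified family by family in `…DomXOne1` – `…DomXOne9` (generated); the glue files dispatch an
arbitrary rival `(a, b, l)` to its family.  This part: the LOWERED column `0` (intended row `m − w + 1`, class `3`, level `w − 1`) and the
LIFTED column `1` (intended row = the junction row `m − w`, class `1`, level `w + 1`).

Honest framing: census-side (lower-bound) construction; nothing here bears on `TropicalB` inside its window or on VP ≠ VNP.
-/

set_option linter.dupNamespace false
set_option autoImplicit false

namespace Summit.ValiantsHypothesis.ValiantsHypothesis.Theorems.LacunarySymmetroidMatrixDescartes.TropicalCensus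

namespace GradedWalk

open Summit.ValiantsHypothesis.ValiantsHypothesis.Theorems.MatrixDescartes.Negative

variable (n : ℕ)

/-! ### interface lemmas for `u = 1` -/

/-- the class map of the `u = 1` excursion: class `3` on column `0`, class `1` on the other block columns, class `0` on the wrap columns. -/
theorem lam_X1 {w : ℕ} (hw : 1 < w) (b : Fin (n + 1)) :
    lam n w 1 1 b = if w ≤ (b : ℕ) then 0 else if (b : ℕ) = 0 then 3 else 1 := by
  rw [lam_X n hw]
  by_cases h1 : w ≤ (b : ℕ)
  · rw [if_pos h1, if_pos h1]
  · rw [if_neg h1, if_neg h1, if_neg (by omega)]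
    by_cases h2 : (b : ℕ) = 0
    · rw [if_pos (by omega), if_pos h2]
    · rw [if_neg (by omega), if_neg h2]

/-- `UX1` on a pre-block row `a ≤ n − w`. -/
theorem UX1_pre {w a : ℕ} (h : a ≤ n - w) : UX1 n w a = gG n * thX n w 1 * (a : ℤ) := by
  unfold UX1; rw [show a - (n - w) = 0 by omega, muX1_zero, add_zero]
/-- `UX1` on the junction row. -/
theorem UX1_R1 {w a : ℕ} (hw : w ≤ n) (h : a = n + 1 - w) : UX1 n w a = gG n * thX n w 1 * (((n + 1 - w + (0)) : ℕ) : ℤ) + SX1R1 n w := by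
  unfold UX1; rw [show a - (n - w) = 1 by omega, muX1_one, show a = n + 1 - w + 0 by omega]
/-- `UX1` on the row `m − w + 1`. -/
theorem UX1_R2 {w a : ℕ} (hw : w ≤ n) (h : a = n + 2 - w) : UX1 n w a = gG n * thX n w 1 * (((n + 1 - w + (1)) : ℕ) : ℤ) + SX1R2 n w := by
  unfold UX1; rw [show a - (n - w) = 2 by omega, muX1_two, show a = n + 1 - w + 1 by omega]
/-- `UX1` on the row `m − w + 2`. -/
theorem UX1_RP {w a : ℕ} (hw : w ≤ n) (h : a = n + 3 - w) : UX1 n w a = gG n * thX n w 1 * (((n + 1 - w + (2)) : ℕ) : ℤ) + SX1P n := by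
  unfold UX1; rw [show a - (n - w) = 3 by omega, muX1_three, show a = n + 1 - w + 2 by omega]
/-- `UX1` on a block row `m − w + j`, `j ≥ 3`. -/
theorem UX1_RL {w a : ℕ} (j : ℕ) (hw : w ≤ n) (hj : 3 ≤ j) (h : a = n + 1 - w + j) :
    UX1 n w a = gG n * thX n w 1 * (((n + 1 - w + (j)) : ℕ) : ℤ) + SX1L n w (j) := by
  unfold UX1; rw [muX1_ge n (show 4 ≤ a - (n - w) by omega), show a - (n - w) - 1 = j by omega, h]

/-! ### slack, column `0` (lowered to the row `m − w + 1`, class `3`) -/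

set_option maxHeartbeats 400000 in
/-- slack of the type-X certificate for `u = 1`: the lowered column `0`. -/
theorem slackX1_c0 (w : ℕ) (hw2 : 2 ≤ w) (hwn : w ≤ n) (a b : Fin (n + 1)) (l : Fin 4)
    (hp : ee n a b l ≠ 0) (hne : perm n w 1 1 b ≠ a ∨ lam n w 1 1 b ≠ l) (hb0 : (b : ℕ) = 0) :
    1 * (thX n w 1 * (dd n l : ℤ) - vv n a b l) <
      UX1 n w a + ((thX n w 1 * (dd n (lam n w 1 1 b) : ℤ) - vv n (perm n w 1 1 b) b (lam n w 1 1 b)) - UX1 n w (perm n w 1 1 b)) := by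
  have hw1 : w ≤ n + 1 := by omega
  have huw : 1 < w := by omega
  have han : (a : ℕ) ≤ n := Nat.lt_succ_iff.mp a.isLt
  have hr : ((perm n w 1 1 b : Fin (n + 1)) : ℕ) = n + 1 - w + 1 := sigmaX_um1 n huw hw1 b (by omega)
  rw [lam_X1 n huw, if_neg (by omega), if_pos hb0] at hne ⊢
  have hlowr : (b : ℕ) < ((perm n w 1 1 b : Fin (n + 1)) : ℕ) := by rw [hr]; omega
  have hwne : w - 1 ≠ n + 1 := by omega
  have hT3 : thX n w 1 * (dd n 3 : ℤ) - vv n (perm n w 1 1 b) b 3 =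
      thX n w 1 * d3 n - ((v1 n (w - 1) (0) + bB n * tau2lt n (w - 1) (0)) + tau3lt n (w - 1) (0)) := by
    rw [dd_cast_three, vv_lower n hlowr, hr, show n + 1 + (b : ℕ) - (n + 1 - w + 1) = w - 1 by omega, vblk_three,
      tau2_of_ne n hwne, tau3_of_ne n hwne, hb0]
  have hUr : UX1 n w ((perm n w 1 1 b : Fin (n + 1)) : ℕ) = gG n * thX n w 1 * (((n + 1 - w + (1)) : ℕ) : ℤ) + SX1R2 n w :=
    UX1_R2 n hwn (by rw [hr]; omega)
  clear hlowr
  rcases Nat.eq_zero_or_pos (a : ℕ) with ha0 | ha0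
  · -- the diagonal cell `(0, 0)`
    have hab' : (a : ℕ) = (b : ℕ) := by omega
    have hY : UX1 n w a - UX1 n w ((perm n w 1 1 b : Fin (n + 1)) : ℕ) =
        ((0 : ℤ) - (gG n * thX n w 1 * (((n + 1 - w + (1)) : ℕ) : ℤ) + SX1R2 n w)) := by
      rw [hUr, UX1_pre n (show (a : ℕ) ≤ n - w by omega), ha0]; simp
    by_cases hcl : l = 0
    · subst hcl
      have hX0 : thX n w 1 * (dd n 0 : ℤ) - vv n a b 0 = thX n w 1 * 0 - 0 := by rw [dd_cast_zero, vv_diag_zero n hab']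
      exact slack_of (X1_c0_dg0 n w hw2 hwn) hX0 hT3 hY
    · have hθ : thX n w 1 ≤ LL n * ((n : ℤ) + 1) := thX_le_top n huw hwn
      have hX1 : thX n w 1 * (dd n 1 : ℤ) - vv n a b 1 = thX n w 1 * d1 n - v1 n (n + 1) (0) := by
        rw [dd_cast_one, vv_diag n hab' 1 (by decide), vblk_one, hb0]
      have hXl : thX n w 1 * (dd n l : ℤ) - vv n a b l + 1 ≤ thX n w 1 * d1 n - v1 n (n + 1) (0) + 1 ∨ l = 1 := by
        rcases (show l = 0 ∨ l = 1 ∨ l = 2 ∨ l = 3 by fin_cases l <;> simp) with rfl | rfl | rfl | rfl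
        · exact absurd rfl hcl
        · exact Or.inr rfl
        · left; rw [dd_cast_two, vv_diag n hab' 2 (by decide), vblk_two, hb0]
          linarith [lift_fut2_top n (θ := thX n w 1) 0 hθ]
        · left; rw [dd_cast_three, vv_diag n hab' 3 (by decide), vblk_three, hb0]
          linarith [lift_fut3_top n (θ := thX n w 1) 0 hθ]
      have hXl : thX n w 1 * (dd n l : ℤ) - vv n a b l ≤ thX n w 1 * d1 n - v1 n (n + 1) (0) := by
        rcases hXl with h | rfl
        · linarith
        · exact le_of_eq hX1
      exact slack_le (X1_c0_dgm n w hw2 hwn) hXl hT3 hY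
  have hlow : (b : ℕ) < (a : ℕ) := by omega
  have hcl : l ≠ 0 := fun h0 => by subst h0; exact hp (ee_lower_zero n hlow)
  rcases Nat.lt_or_ge (a : ℕ) (n + 1 - w) with hpre | hge
  · -- pre-block rows: future levels `E = m − a ≥ w + 1`, class 1 best
    obtain ⟨E, hE⟩ : ∃ E, n + 1 + (b : ℕ) - (a : ℕ) = E := ⟨_, rfl⟩
    have hE1 : w + 1 ≤ E := by omega
    have hEn : E ≤ n := by omega
    have hne1 : E ≠ n + 1 := by omega
    have hθ : thX n w 1 ≤ LL n * ((E : ℕ) : ℤ) := thX_le_LE n huw hwn hE1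
    have hX1 : thX n w 1 * (dd n 1 : ℤ) - vv n a b 1 = thX n w 1 * d1 n - v1 n (E) (0) := by
      rw [dd_cast_one, vv_lower n hlow, hE, vblk_one, hb0]
    have hXl : thX n w 1 * (dd n l : ℤ) - vv n a b l + 1 ≤ thX n w 1 * d1 n - v1 n (E) (0) + 1 ∨ l = 1 := by
      rcases (show l = 0 ∨ l = 1 ∨ l = 2 ∨ l = 3 by fin_cases l <;> simp) with rfl | rfl | rfl | rfl
      · exact absurd rfl hcl
      · exact Or.inr rfl
      · left; rw [dd_cast_two, vv_lower n hlow, hE, vblk_two, tau2_of_ne n hne1, hb0]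
        linarith [lift_fut2 n (θ := thX n w 1) (E := E) 0 hθ]
      · left; rw [dd_cast_three, vv_lower n hlow, hE, vblk_three, tau2_of_ne n hne1, tau3_of_ne n hne1, hb0]
        linarith [lift_fut3 n (θ := thX n w 1) (E := E) 0 hθ]
    have hXl : thX n w 1 * (dd n l : ℤ) - vv n a b l ≤ thX n w 1 * d1 n - v1 n (E) (0) := by
      rcases hXl with h | rfl
      · linarith
      · exact le_of_eq hX1
    have hY : UX1 n w a - UX1 n w ((perm n w 1 1 b : Fin (n + 1)) : ℕ) =
        (gG n * thX n w 1 * (((n + 1 - E) : ℕ) : ℤ) - (gG n * thX n w 1 * (((n + 1 - w + (1)) : ℕ) : ℤ) + SX1R2 n w)) := by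
      rw [hUr, UX1_pre n (show (a : ℕ) ≤ n - w by omega), show (a : ℕ) = n + 1 - E by omega]
    exact slack_le (X1_c0_up n w E hw2 hE1 hEn) hXl hT3 hY
  rcases Nat.lt_trichotomy (a : ℕ) (n + 1 - w + 1) with haR1 | haR2 | hagt
  · -- the junction row `R₁` (level `w`)
    have hEa : n + 1 + (b : ℕ) - (a : ℕ) = w := by omega
    have hwne' : w ≠ n + 1 := by omega
    have hY : UX1 n w a - UX1 n w ((perm n w 1 1 b : Fin (n + 1)) : ℕ) =
        ((gG n * thX n w 1 * (((n + 1 - w + (0)) : ℕ) : ℤ) + SX1R1 n w) - (gG n * thX n w 1 * (((n + 1 - w + (1)) : ℕ) : ℤ) + SX1R2 n w)) := by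
      rw [hUr, UX1_R1 n hwn (show (a : ℕ) = n + 1 - w by omega)]
    rcases (show l = 0 ∨ l = 1 ∨ l = 2 ∨ l = 3 by fin_cases l <;> simp) with rfl | rfl | rfl | rfl
    · exact absurd rfl hcl
    · have hX : thX n w 1 * (dd n 1 : ℤ) - vv n a b 1 = thX n w 1 * d1 n - v1 n (w) (0) := by
        rw [dd_cast_one, vv_lower n hlow, hEa, vblk_one, hb0]
      exact slack_of (X1_c0_R1_l1 n w hw2 hwn) hX hT3 hY
    · have hX : thX n w 1 * (dd n 2 : ℤ) - vv n a b 2 = thX n w 1 * d2 n - (v1 n (w) (0) + bB n * tau2lt n (w) (0)) := by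
        rw [dd_cast_two, vv_lower n hlow, hEa, vblk_two, tau2_of_ne n hwne', hb0]
      exact slack_of (X1_c0_R1_l2 n w hw2 hwn) hX hT3 hY
    · have hX : thX n w 1 * (dd n 3 : ℤ) - vv n a b 3 = thX n w 1 * d3 n - ((v1 n (w) (0) + bB n * tau2lt n (w) (0)) + tau3lt n (w) (0)) := by
        rw [dd_cast_three, vv_lower n hlow, hEa, vblk_three, tau2_of_ne n hwne', tau3_of_ne n hwne', hb0]
      exact slack_of (X1_c0_R1_l3 n w hw2 hwn) hX hT3 hY
  · -- class rivals at the intended cell (past level `w − 1`)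
    have hrot : perm n w 1 1 b = a := Fin.ext (by rw [hr, haR2])
    have hY : UX1 n w a - UX1 n w ((perm n w 1 1 b : Fin (n + 1)) : ℕ) = 0 := by rw [hrot]; ring
    have hEa : n + 1 + (b : ℕ) - (a : ℕ) = w - 1 := by omega
    have hθ : LL n * ((w - 1 : ℕ) + 1) ≤ thX n w 1 := LE_le_thX n 1 (by omega)
    rcases (show l = 0 ∨ l = 1 ∨ l = 2 ∨ l = 3 by fin_cases l <;> simp) with rfl | rfl | rfl | rfl
    · exact absurd rfl hcl
    · have hX : thX n w 1 * (dd n 1 : ℤ) - vv n a b 1 = thX n w 1 * d1 n - v1 n (w - 1) (0) := by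
        rw [dd_cast_one, vv_lower n hlow, hEa, vblk_one, hb0]
      exact slack_of0 (lift_past1 n (θ := thX n w 1) (c := 0) (by omega) (by omega) hθ) hX hT3 hY
    · have hX : thX n w 1 * (dd n 2 : ℤ) - vv n a b 2 = thX n w 1 * d2 n - (v1 n (w - 1) (0) + bB n * tau2lt n (w - 1) (0)) := by
        rw [dd_cast_two, vv_lower n hlow, hEa, vblk_two, tau2_of_ne n hwne, hb0]
      exact slack_of0 (lift_past2 n (θ := thX n w 1) (c := 0) (by omega) (by omega) hθ) hX hT3 hY
    · exact absurd rfl (hne.resolve_left (fun h => h hrot))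
  · -- below the intended cell: past levels, class 3 best
    obtain ⟨k, hk⟩ : ∃ k, (a : ℕ) = (n + 1 - w + 1) + k := ⟨(a : ℕ) - (n + 1 - w + 1), by omega⟩
    have hk1 : 1 ≤ k := by clear hT3 hUr hr; omega
    have hkw : k + 2 ≤ w := by clear hT3 hUr hr; omega
    have hEa : n + 1 + (b : ℕ) - (a : ℕ) = w - 1 - k := by clear hT3 hUr hr; omega
    have hne3 : w - 1 - k ≠ n + 1 := by clear hT3 hUr hr hEa; omega
    have hEn : w - 1 - k ≤ n := by clear hT3 hUr hr hEa hne3; omega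
    have hθ : LL n * ((w - 1 - k : ℕ) + 1) ≤ thX n w 1 :=
      LE_le_thX n 1 (by clear hT3 hUr hr hEa hne3 hEn; omega)
    have hX3 : thX n w 1 * (dd n 3 : ℤ) - vv n a b 3 = thX n w 1 * d3 n - ((v1 n (w - 1 - k) (0) + bB n * tau2lt n (w - 1 - k) (0)) + tau3lt n (w - 1 - k) (0)) := by
      rw [dd_cast_three, vv_lower n hlow, hEa, vblk_three, tau2_of_ne n hne3, tau3_of_ne n hne3, hb0]
    have hlift : thX n w 1 * (dd n l : ℤ) - vv n a b l + (if l = 3 then 0 else 1) ≤ thX n w 1 * d3 n - ((v1 n (w - 1 - k) (0) + bB n * tau2lt n (w - 1 - k) (0)) + tau3lt n (w - 1 - k) (0)) := by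
      rcases (show l = 0 ∨ l = 1 ∨ l = 2 ∨ l = 3 by fin_cases l <;> simp) with rfl | rfl | rfl | rfl
      · exact absurd rfl hcl
      · rw [dd_cast_one, vv_lower n hlow, hEa, vblk_one, hb0]
        simp only [show ((1 : Fin 4) = 3) = False by decide, ite_false]
        linarith [lift_past1 n (θ := thX n w 1) (c := 0) (E := w - 1 - k) (by omega) hEn hθ]
      · rw [dd_cast_two, vv_lower n hlow, hEa, vblk_two, tau2_of_ne n hne3, hb0]
        simp only [show ((2 : Fin 4) = 3) = False by decide, ite_false]
        linarith [lift_past2 n (θ := thX n w 1) (c := 0) (E := w - 1 - k) (by omega) hEn hθ]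
      · rw [hX3]; simp
    clear hX3 hEa hne3 hEn hθ
    rcases Nat.lt_or_ge k 2 with hk2 | hk2
    · have hkone : k = 1 := by clear hT3 hUr hlift hr; omega
      subst hkone
      have hY : UX1 n w a - UX1 n w ((perm n w 1 1 b : Fin (n + 1)) : ℕ) =
          ((gG n * thX n w 1 * (((n + 1 - w + (2)) : ℕ) : ℤ) + SX1P n) - (gG n * thX n w 1 * (((n + 1 - w + (1)) : ℕ) : ℤ) + SX1R2 n w)) := by
        rw [hUr, UX1_RP n hwn (by clear hT3 hUr hlift hr; omega)]
      have hF := X1_c0_down_P n w (by clear hT3 hUr hlift hr hY; omega) hwn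
      rw [show w - 1 - 1 = w - 2 from (by clear hT3 hUr hlift hr hY hF; omega)] at hlift
      exact slack_of (lift_combine hlift hF) rfl hT3 hY
    · have hY : UX1 n w a - UX1 n w ((perm n w 1 1 b : Fin (n + 1)) : ℕ) =
          ((gG n * thX n w 1 * (((n + 1 - w + (1 + k)) : ℕ) : ℤ) + SX1L n w (1 + k)) - (gG n * thX n w 1 * (((n + 1 - w + (1)) : ℕ) : ℤ) + SX1R2 n w)) := by
        rw [hUr, UX1_RL n (1 + k) hwn (by omega) (by clear hT3 hUr hlift hr; omega)]
      have hF := X1_c0_down_ge n w k hk2 hkw hwn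
      exact slack_of (lift_combine hlift hF) rfl hT3 hY

/-! ### slack, column `1` (lifted to the junction row `m − w`, class `1`) -/

set_option maxHeartbeats 400000 in
/-- slack of the type-X certificate for `u = 1`: the lifted column `1`. -/
theorem slackX1_c1 (w : ℕ) (hw2 : 2 ≤ w) (hwn : w ≤ n) (a b : Fin (n + 1)) (l : Fin 4)
    (hp : ee n a b l ≠ 0) (hne : perm n w 1 1 b ≠ a ∨ lam n w 1 1 b ≠ l) (hb1 : (b : ℕ) = 1) :
    1 * (thX n w 1 * (dd n l : ℤ) - vv n a b l) <
      UX1 n w a + ((thX n w 1 * (dd n (lam n w 1 1 b) : ℤ) - vv n (perm n w 1 1 b) b (lam n w 1 1 b)) - UX1 n w (perm n w 1 1 b)) := by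
  have hw1 : w ≤ n + 1 := by omega
  have huw : 1 < w := by omega
  have han : (a : ℕ) ≤ n := Nat.lt_succ_iff.mp a.isLt
  have hr : ((perm n w 1 1 b : Fin (n + 1)) : ℕ) = n + 1 - w := by
    rw [sigmaX_u n huw hwn b hb1]; omega
  rw [lam_X1 n huw, if_neg (by omega), if_neg (by omega)] at hne ⊢
  have hT1 : thX n w 1 * (dd n 1 : ℤ) - vv n (perm n w 1 1 b) b 1 = thX n w 1 * d1 n - v1 n (w + 1) (1) := by
    rcases Nat.lt_or_ge w n with hwn' | hwn'
    · have hlowr : (b : ℕ) < ((perm n w 1 1 b : Fin (n + 1)) : ℕ) := by rw [hr]; omega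
      rw [dd_cast_one, vv_lower n hlowr, hr, show n + 1 + (b : ℕ) - (n + 1 - w) = w + 1 by omega, vblk_one, hb1]
    · have hdg : (((perm n w 1 1 b : Fin (n + 1)) : ℕ)) = (b : ℕ) := by rw [hr]; omega
      rw [dd_cast_one, vv_diag n hdg 1 (by decide), vblk_one, hb1, show n + 1 = w + 1 by omega]
  have hUr : UX1 n w ((perm n w 1 1 b : Fin (n + 1)) : ℕ) = gG n * thX n w 1 * (((n + 1 - w + (0)) : ℕ) : ℤ) + SX1R1 n w :=
    UX1_R1 n hwn hr
  rcases Nat.eq_zero_or_pos (a : ℕ) with ha0 | ha0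
  · -- the row `0` (upper cell): classes 0 / 1
    have hab : (a : ℕ) < (b : ℕ) := by omega
    have hY : UX1 n w a - UX1 n w ((perm n w 1 1 b : Fin (n + 1)) : ℕ) =
        ((0 : ℤ) - (gG n * thX n w 1 * (((n + 1 - w + (0)) : ℕ) : ℤ) + SX1R1 n w)) := by
      rw [hUr, UX1_pre n (show (a : ℕ) ≤ n - w by omega), ha0]; simp
    rcases (show l = 0 ∨ l = 1 ∨ l = 2 ∨ l = 3 by fin_cases l <;> simp) with rfl | rfl | rfl | rfl
    · have hX : thX n w 1 * (dd n 0 : ℤ) - vv n a b 0 = ((0 : ℤ) - 4 * mZ n * gG n ^ 2 * (((1) : ℕ) : ℤ) ^ 2) := by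
        rw [dd_cast_zero, vv_upper_zero n hab, hb1, ha0]; simp
      exact slack_of (X1_c1_w0_R0 n w hw2 hwn) hX hT1 hY
    · have hX : thX n w 1 * (dd n 1 : ℤ) - vv n a b 1 = (thX n w 1 * d1 n - conn n (1) (1)) := by
        rw [dd_cast_one, vv_upper_one n hab, hb1, ha0]
      exact slack_of (X1_c1_cn_R0 n w hw2 hwn) hX hT1 hY
    · exact absurd (ee_upper_ge_two n hab 2 (by decide)) hp
    · exact absurd (ee_upper_ge_two n hab 3 (by decide)) hp
  rcases Nat.lt_or_ge (a : ℕ) 2 with ha1 | ha2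
  · -- the diagonal cell `(1, 1)`
    have hab' : (a : ℕ) = (b : ℕ) := by omega
    rcases Nat.lt_or_ge w n with hwn' | hwn'
    · have hY : UX1 n w a - UX1 n w ((perm n w 1 1 b : Fin (n + 1)) : ℕ) =
          (gG n * thX n w 1 * (((1) : ℕ) : ℤ) - (gG n * thX n w 1 * (((n + 1 - w + (0)) : ℕ) : ℤ) + SX1R1 n w)) := by
        rw [hUr, UX1_pre n (show (a : ℕ) ≤ n - w by omega), show (a : ℕ) = 1 by omega]
      by_cases hcl : l = 0
      · subst hcl
        have hX0 : thX n w 1 * (dd n 0 : ℤ) - vv n a b 0 = thX n w 1 * 0 - 0 := by rw [dd_cast_zero, vv_diag_zero n hab']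
        exact slack_of (X1_c1_dg0_P n w hw2 (by omega)) hX0 hT1 hY
      · have hθ : thX n w 1 ≤ LL n * ((n : ℤ) + 1) := thX_le_top n huw hwn
        have hX1 : thX n w 1 * (dd n 1 : ℤ) - vv n a b 1 = thX n w 1 * d1 n - v1 n (n + 1) (1) := by
          rw [dd_cast_one, vv_diag n hab' 1 (by decide), vblk_one, hb1]
        have hXl : thX n w 1 * (dd n l : ℤ) - vv n a b l + 1 ≤ thX n w 1 * d1 n - v1 n (n + 1) (1) + 1 ∨ l = 1 := by
          rcases (show l = 0 ∨ l = 1 ∨ l = 2 ∨ l = 3 by fin_cases l <;> simp) with rfl | rfl | rfl | rfl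
          · exact absurd rfl hcl
          · exact Or.inr rfl
          · left; rw [dd_cast_two, vv_diag n hab' 2 (by decide), vblk_two, hb1]
            linarith [lift_fut2_top n (θ := thX n w 1) 1 hθ]
          · left; rw [dd_cast_three, vv_diag n hab' 3 (by decide), vblk_three, hb1]
            linarith [lift_fut3_top n (θ := thX n w 1) 1 hθ]
        have hXl : thX n w 1 * (dd n l : ℤ) - vv n a b l ≤ thX n w 1 * d1 n - v1 n (n + 1) (1) := by
          rcases hXl with h | rfl
          · linarith
          · exact le_of_eq hX1
        exact slack_le (X1_c1_dgm_P n w hw2 (by omega)) hXl hT1 hY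
    · -- `w = n`: the diagonal cell is the intended cell
      have hrot : perm n w 1 1 b = a := Fin.ext (by rw [hr]; omega)
      have hY : UX1 n w a - UX1 n w ((perm n w 1 1 b : Fin (n + 1)) : ℕ) = 0 := by rw [hrot]; ring
      have hθ : thX n w 1 ≤ LL n * ((n : ℤ) + 1) := thX_le_top n huw hwn
      rcases (show l = 0 ∨ l = 1 ∨ l = 2 ∨ l = 3 by fin_cases l <;> simp) with rfl | rfl | rfl | rfl
      · have hX0 : thX n w 1 * (dd n 0 : ℤ) - vv n a b 0 = thX n w 1 * 0 - 0 := by rw [dd_cast_zero, vv_diag_zero n hab']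
        exact slack_of0 (X1_c1_dg0_at n w hw2 (by omega)) hX0 hT1 hY
      · exact absurd rfl (hne.resolve_left (fun h => h hrot))
      · have hX : thX n w 1 * (dd n 2 : ℤ) - vv n a b 2 = thX n w 1 * d2 n - (v1 n (n + 1) (1) + bB n * tau2 n (n + 1) (1)) := by
          rw [dd_cast_two, vv_diag n hab' 2 (by decide), vblk_two, hb1]
        have hF := lift_fut2_top n (θ := thX n w 1) 1 hθ
        rw [show n + 1 = w + 1 by omega] at hF hX
        exact slack_of0 hF hX hT1 hY
      · have hX : thX n w 1 * (dd n 3 : ℤ) - vv n a b 3 = thX n w 1 * d3 n - (v1 n (n + 1) (1) + bB n * tau2 n (n + 1) (1) + tau3 n (n + 1) (1)) := by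
          rw [dd_cast_three, vv_diag n hab' 3 (by decide), vblk_three, hb1]
        have hF := lift_fut3_top n (θ := thX n w 1) 1 hθ
        rw [show n + 1 = w + 1 by omega] at hF hX
        exact slack_of0 hF hX hT1 hY
  have hlow : (b : ℕ) < (a : ℕ) := by omega
  have hcl : l ≠ 0 := fun h0 => by subst h0; exact hp (ee_lower_zero n hlow)
  rcases Nat.lt_or_ge (a : ℕ) (n + 1 - w) with hpre | hge
  · -- pre-block rows: future levels `E = m + 1 − a ≥ w + 2`, class 1 best
    obtain ⟨E, hE⟩ : ∃ E, n + 1 + (b : ℕ) - (a : ℕ) = E := ⟨_, rfl⟩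
    have hE1 : w + 2 ≤ E := by omega
    have hEn : E ≤ n := by omega
    have hne1 : E ≠ n + 1 := by omega
    have hθ : thX n w 1 ≤ LL n * ((E : ℕ) : ℤ) := thX_le_LE n huw hwn (by omega)
    have hX1 : thX n w 1 * (dd n 1 : ℤ) - vv n a b 1 = thX n w 1 * d1 n - v1 n (E) (1) := by
      rw [dd_cast_one, vv_lower n hlow, hE, vblk_one, hb1]
    have hXl : thX n w 1 * (dd n l : ℤ) - vv n a b l + 1 ≤ thX n w 1 * d1 n - v1 n (E) (1) + 1 ∨ l = 1 := by
      rcases (show l = 0 ∨ l = 1 ∨ l = 2 ∨ l = 3 by fin_cases l <;> simp) with rfl | rfl | rfl | rfl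
      · exact absurd rfl hcl
      · exact Or.inr rfl
      · left; rw [dd_cast_two, vv_lower n hlow, hE, vblk_two, tau2_of_ne n hne1, hb1]
        linarith [lift_fut2 n (θ := thX n w 1) (E := E) 1 hθ]
      · left; rw [dd_cast_three, vv_lower n hlow, hE, vblk_three, tau2_of_ne n hne1, tau3_of_ne n hne1, hb1]
        linarith [lift_fut3 n (θ := thX n w 1) (E := E) 1 hθ]
    have hXl : thX n w 1 * (dd n l : ℤ) - vv n a b l ≤ thX n w 1 * d1 n - v1 n (E) (1) := by
      rcases hXl with h | rfl
      · linarith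
      · exact le_of_eq hX1
    have hY : UX1 n w a - UX1 n w ((perm n w 1 1 b : Fin (n + 1)) : ℕ) =
        (gG n * thX n w 1 * (((n + 2 - E) : ℕ) : ℤ) - (gG n * thX n w 1 * (((n + 1 - w + (0)) : ℕ) : ℤ) + SX1R1 n w)) := by
      rw [hUr, UX1_pre n (show (a : ℕ) ≤ n - w by omega), show (a : ℕ) = n + 2 - E by omega]
    exact slack_le (X1_c1_up n w E hw2 hE1 hEn) hXl hT1 hY
  rcases Nat.lt_trichotomy (a : ℕ) (n + 1 - w + 1) with haR1 | haR2 | hagt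
  · -- the intended cell (`w < n`; for `w = n` it is the diagonal, treated above)
    have hrot : perm n w 1 1 b = a := Fin.ext (by rw [hr]; omega)
    have hY : UX1 n w a - UX1 n w ((perm n w 1 1 b : Fin (n + 1)) : ℕ) = 0 := by rw [hrot]; ring
    have hEa : n + 1 + (b : ℕ) - (a : ℕ) = w + 1 := by omega
    have hne1 : w + 1 ≠ n + 1 := by omega
    have hθ : thX n w 1 ≤ LL n * ((w + 1 : ℕ) : ℤ) := thX_le_LE n huw hwn (le_refl _)
    rcases (show l = 0 ∨ l = 1 ∨ l = 2 ∨ l = 3 by fin_cases l <;> simp) with rfl | rfl | rfl | rfl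
    · exact absurd rfl hcl
    · exact absurd rfl (hne.resolve_left (fun h => h hrot))
    · have hX : thX n w 1 * (dd n 2 : ℤ) - vv n a b 2 = thX n w 1 * d2 n - (v1 n (w + 1) (1) + bB n * tau2lt n (w + 1) (1)) := by
        rw [dd_cast_two, vv_lower n hlow, hEa, vblk_two, tau2_of_ne n hne1, hb1]
      exact slack_of0 (lift_fut2 n (θ := thX n w 1) (E := w + 1) 1 hθ) hX hT1 hY
    · have hX : thX n w 1 * (dd n 3 : ℤ) - vv n a b 3 = thX n w 1 * d3 n - (v1 n (w + 1) (1) + bB n * tau2lt n (w + 1) (1) + tau3lt n (w + 1) (1)) := by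
        rw [dd_cast_three, vv_lower n hlow, hEa, vblk_three, tau2_of_ne n hne1, tau3_of_ne n hne1, hb1]
      exact slack_of0 (lift_fut3 n (θ := thX n w 1) (E := w + 1) 1 hθ) hX hT1 hY
  · -- the row `m − w + 1` (level `w`)
    have hEa : n + 1 + (b : ℕ) - (a : ℕ) = w := by omega
    have hwne : w ≠ n + 1 := by omega
    have hY : UX1 n w a - UX1 n w ((perm n w 1 1 b : Fin (n + 1)) : ℕ) =
        ((gG n * thX n w 1 * (((n + 1 - w + (1)) : ℕ) : ℤ) + SX1R2 n w) - (gG n * thX n w 1 * (((n + 1 - w + (0)) : ℕ) : ℤ) + SX1R1 n w)) := by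
      rw [hUr, UX1_R2 n hwn (by omega)]
    rcases (show l = 0 ∨ l = 1 ∨ l = 2 ∨ l = 3 by fin_cases l <;> simp) with rfl | rfl | rfl | rfl
    · exact absurd rfl hcl
    · have hX : thX n w 1 * (dd n 1 : ℤ) - vv n a b 1 = thX n w 1 * d1 n - v1 n (w) (1) := by
        rw [dd_cast_one, vv_lower n hlow, hEa, vblk_one, hb1]
      exact slack_of (X1_c1_R2_l1 n w hw2 hwn) hX hT1 hY
    · have hX : thX n w 1 * (dd n 2 : ℤ) - vv n a b 2 = thX n w 1 * d2 n - (v1 n (w) (1) + bB n * tau2lt n (w) (1)) := by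
        rw [dd_cast_two, vv_lower n hlow, hEa, vblk_two, tau2_of_ne n hwne, hb1]
      exact slack_of (X1_c1_R2_l2 n w hw2 hwn) hX hT1 hY
    · have hX : thX n w 1 * (dd n 3 : ℤ) - vv n a b 3 = thX n w 1 * d3 n - ((v1 n (w) (1) + bB n * tau2lt n (w) (1)) + tau3lt n (w) (1)) := by
        rw [dd_cast_three, vv_lower n hlow, hEa, vblk_three, tau2_of_ne n hwne, tau3_of_ne n hwne, hb1]
      exact slack_of (X1_c1_R2_l3 n w hw2 hwn) hX hT1 hY
  · -- below: past levels, class 3 best; rows `m − w + j`, `j ≥ 2`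
    obtain ⟨j, hj⟩ : ∃ j, (a : ℕ) = (n + 1 - w) + j := ⟨(a : ℕ) - (n + 1 - w), by omega⟩
    have hj2 : 2 ≤ j := by clear hT1 hUr hr; omega
    have hjw : j + 1 ≤ w := by clear hT1 hUr hr; omega
    have hEa : n + 1 + (b : ℕ) - (a : ℕ) = w + 1 - j := by clear hT1 hUr hr; omega
    have hne3 : w + 1 - j ≠ n + 1 := by clear hT1 hUr hr hEa; omega
    have hEn : w + 1 - j ≤ n := by clear hT1 hUr hr hEa hne3; omega
    have hθ : LL n * ((w + 1 - j : ℕ) + 1) ≤ thX n w 1 :=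
      LE_le_thX n 1 (by clear hT1 hUr hr hEa hne3 hEn; omega)
    have hX3 : thX n w 1 * (dd n 3 : ℤ) - vv n a b 3 = thX n w 1 * d3 n - ((v1 n (w + 1 - j) (1) + bB n * tau2lt n (w + 1 - j) (1)) + tau3lt n (w + 1 - j) (1)) := by
      rw [dd_cast_three, vv_lower n hlow, hEa, vblk_three, tau2_of_ne n hne3, tau3_of_ne n hne3, hb1]
    have hlift : thX n w 1 * (dd n l : ℤ) - vv n a b l + (if l = 3 then 0 else 1) ≤ thX n w 1 * d3 n - ((v1 n (w + 1 - j) (1) + bB n * tau2lt n (w + 1 - j) (1)) + tau3lt n (w + 1 - j) (1)) := by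
      rcases (show l = 0 ∨ l = 1 ∨ l = 2 ∨ l = 3 by fin_cases l <;> simp) with rfl | rfl | rfl | rfl
      · exact absurd rfl hcl
      · rw [dd_cast_one, vv_lower n hlow, hEa, vblk_one, hb1]
        simp only [show ((1 : Fin 4) = 3) = False by decide, ite_false]
        linarith [lift_past1 n (θ := thX n w 1) (c := 1) (E := w + 1 - j) (by omega) hEn hθ]
      · rw [dd_cast_two, vv_lower n hlow, hEa, vblk_two, tau2_of_ne n hne3, hb1]
        simp only [show ((2 : Fin 4) = 3) = False by decide, ite_false]
        linarith [lift_past2 n (θ := thX n w 1) (c := 1) (E := w + 1 - j) (by omega) hEn hθ]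
      · rw [hX3]; simp
    clear hX3 hEa hne3 hEn hθ
    rcases Nat.lt_or_ge j 3 with hj3 | hj3
    · have hjtwo : j = 2 := by clear hT1 hUr hlift hr; omega
      subst hjtwo
      have hY : UX1 n w a - UX1 n w ((perm n w 1 1 b : Fin (n + 1)) : ℕ) =
          ((gG n * thX n w 1 * (((n + 1 - w + (2)) : ℕ) : ℤ) + SX1P n) - (gG n * thX n w 1 * (((n + 1 - w + (0)) : ℕ) : ℤ) + SX1R1 n w)) := by
        rw [hUr, UX1_RP n hwn (by clear hT1 hUr hlift hr; omega)]
      have hF := X1_c1_down_P n w (by clear hT1 hUr hlift hr hY; omega) hwn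
      rw [show w + 1 - 2 = w - 1 from (by clear hT1 hUr hlift hr hY hF; omega)] at hlift
      exact slack_of (lift_combine hlift hF) rfl hT1 hY
    · have hY : UX1 n w a - UX1 n w ((perm n w 1 1 b : Fin (n + 1)) : ℕ) =
          ((gG n * thX n w 1 * (((n + 1 - w + (j)) : ℕ) : ℤ) + SX1L n w (j)) - (gG n * thX n w 1 * (((n + 1 - w + (0)) : ℕ) : ℤ) + SX1R1 n w)) := by
        rw [hUr, UX1_RL n j hwn hj3 hj]
      have hF := X1_c1_down_ge n w j hj3 hjw hwn
      exact slack_of (lift_combine hlift hF) rfl hT1 hY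

end GradedWalk

end Summit.ValiantsHypothesis.ValiantsHypothesis.Theorems.LacunarySymmetroidMatrixDescartes.TropicalCensus
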